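import Mathlib
import HarnessLib
import Summits.Ventures.LatticeQCDFlow.Exactness.NCMCGeneralSpaceBennettOptimal

/-!
# Bennett's optimal weight on a general state space: the equality case

HONEST FRAMING: exact (Metropolis-corrected) sampling algorithms for lattice gauge theory;
figures of merit are autocorrelation/cost numbers at stated couplings and volumes; no
continuum-physics claim.

Venture `LatticeQCDFlow` (cell pub-lqcd), topic `Exactness`; FANOUT row 13 (`eng-snf`, GEN-11).
NEW WORK of the cell (general measure theory, elementary), not a published result; nothing is
cited as a fact (C. H. Bennett, J. Comput. Phys. 22 (1976) 245 named only).  Companion of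
`NCMCGeneralSpaceBennettOptimal.lean` (`bennett_lower_bound`, `bennett_bound_attained`); general-space
counterpart of the finite `BennettOptimalWeight.bennettVar_eq_bound_iff`.  Setting: a Crooks pair from
`ν₀` to `ν₁`, `P_F`, `P_R`, `e^{−ΔF} = Z₁/Z₀`, sample sizes `nf, nr > 0`, `g = e^{ΔF−W}/nf + 1/nr`,
`G = E_{P_R}[1/g]`, the two-sample variance functional `V(α)`.

## Content

* `integral_mul_sq_mul_integral_inv_sub_sq` — the completed square as an IDENTITY on a probability
  law: `E[g α²]·E[1/g] − E[α]² = E[1/g] · E[g (α − c/g)²]`, `c = E[α]/E[1/g]`.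
* **`CrooksPair.bennett_eq_bound_iff`** — UNIQUENESS OF THE OPTIMUM: for a measurable statistic `α`
  of the record with `E_R[α] ≠ 0`, `α²` and `e^{ΔF−W} α²` in `L¹(P_R)`,
  `V(α) = 1/G − 1/nf − 1/nr ↔ α = (E_R[α]/G) · (1/g)` `P_R`-almost surely — the bound is attained
  exactly by the `P_R`-a.s. constant multiples of `1/g = nr · σ(log(nf/nr) + W − ΔF)`
  (`NCMCGeneralSpaceBennettOptimal.bennettWeight_eq_inv_g`): no statistic OF THE WHOLE EVOLUTION RECORD
  beats the Fermi function OF THE WORK ALONE, and only its multiples match it.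

Nothing is claimed about finite-sample or autocorrelation corrections.
-/

namespace Summit.Ventures.LatticeQCDFlow.Exactness.GeneralNCMC

open MeasureTheory ProbabilityTheory Set Filter
open scoped ENNReal

variable {Ω E : Type*} [MeasurableSpace Ω] [MeasurableSpace E]

/-- **The completed square as an identity**: for a positive `g` with `α`, `g α²`, `1/g` integrable
and `G = E[1/g] > 0` (probability law `μ`),
`E[g α²] · G − E[α]² = G · E[g (α − (E[α]/G)/g)²]`. -/
theorem integral_mul_sq_mul_integral_inv_sub_sq {μ : Measure E} [IsProbabilityMeasure μ]
    {g α : E → ℝ} (hgpos : ∀ ε, 0 < g ε) (hα : Integrable α μ)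
    (hgα2 : Integrable (fun ε => g ε * α ε ^ 2) μ) (hginv : Integrable (fun ε => (g ε)⁻¹) μ)
    (hG : 0 < ∫ ε, (g ε)⁻¹ ∂μ) :
    (∫ ε, g ε * α ε ^ 2 ∂μ) * (∫ ε, (g ε)⁻¹ ∂μ) - (∫ ε, α ε ∂μ) ^ 2 =
      (∫ ε, (g ε)⁻¹ ∂μ) *
        ∫ ε, g ε * (α ε - (∫ x, α x ∂μ) / (∫ x, (g x)⁻¹ ∂μ) * (g ε)⁻¹) ^ 2 ∂μ := by
  set A := ∫ ε, α ε ∂μ with hA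
  set G := ∫ ε, (g ε)⁻¹ ∂μ with hGdef
  set c := A / G with hc
  have hexp : ∀ ε, g ε * (α ε - c * (g ε)⁻¹) ^ 2 =
      g ε * α ε ^ 2 - 2 * c * α ε + c ^ 2 * (g ε)⁻¹ := fun ε => by
    have hg0 : g ε ≠ 0 := (hgpos ε).ne'
    field_simp
    ring
  have hI1 : Integrable (fun ε => g ε * α ε ^ 2 - 2 * c * α ε) μ := hgα2.sub (hα.const_mul _)
  have hI2 : Integrable (fun ε => c ^ 2 * (g ε)⁻¹) μ := hginv.const_mul _
  simp_rw [hexp]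
  rw [integral_add hI1 hI2, integral_sub hgα2 (hα.const_mul _), integral_const_mul, integral_const_mul,
    ← hA, ← hGdef, hc]
  field_simp
  ring

namespace CrooksPair

variable {ν₀ ν₁ : Measure Ω} {κF κR : Kernel Ω E} {s e : E → Ω} {W : E → ℝ}

/-- **Uniqueness of Bennett's optimum on a general state space.**  For a measurable statistic `α` of
the record with `E_R[α] ≠ 0`, `α² ∈ L¹(P_R)` and `e^{ΔF−W} α² ∈ L¹(P_R)`: the two-sample variance
functional attains Bennett's bound, `V(α) = 1/G − 1/nf − 1/nr`, iff
`α = (E_R[α]/G) · (1/g)` `P_R`-almost surely, `g = e^{ΔF−W}/nf + 1/nr` — i.e. iff `α` is an a.s.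
constant multiple of the Fermi weight `σ(log(nf/nr) + W − ΔF) = (1/nr)/g`. -/
theorem bennett_eq_bound_iff [IsFiniteMeasure ν₀] [IsFiniteMeasure ν₁] [IsMarkovKernel κF]
    [IsMarkovKernel κR] (h0 : ν₀ univ ≠ 0) (h1 : ν₁ univ ≠ 0) (h : CrooksPair ν₀ ν₁ κF κR s e W)
    {ΔF : ℝ} (hΔF : Real.exp (-ΔF) = ((ν₀ univ)⁻¹ * ν₁ univ).toReal) {nf nr : ℝ} (hnf : 0 < nf)
    (hnr : 0 < nr) {α : E → ℝ} (hαm : Measurable α) (hA : ∫ ε, α ε ∂(fwdPathLaw ν₁ κR) ≠ 0)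
    (hα2 : Integrable (fun ε => α ε ^ 2) (fwdPathLaw ν₁ κR))
    (hα2w : Integrable (fun ε => Real.exp (ΔF - W ε) * α ε ^ 2) (fwdPathLaw ν₁ κR)) :
    ((∫ ε, (α ε * Real.exp (-W ε)) ^ 2 ∂(fwdPathLaw ν₀ κF)) /
            (∫ ε, α ε * Real.exp (-W ε) ∂(fwdPathLaw ν₀ κF)) ^ 2 - 1) / nf +
        ((∫ ε, α ε ^ 2 ∂(fwdPathLaw ν₁ κR)) / (∫ ε, α ε ∂(fwdPathLaw ν₁ κR)) ^ 2 - 1) / nr =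
      1 / (∫ ε, (Real.exp (ΔF - W ε) / nf + 1 / nr)⁻¹ ∂(fwdPathLaw ν₁ κR)) - 1 / nf - 1 / nr ↔
      (fun ε => α ε) =ᵐ[fwdPathLaw ν₁ κR] fun ε =>
        (∫ x, α x ∂(fwdPathLaw ν₁ κR)) / (∫ x, (Real.exp (ΔF - W x) / nf + 1 / nr)⁻¹ ∂(fwdPathLaw ν₁ κR)) *
          (Real.exp (ΔF - W ε) / nf + 1 / nr)⁻¹ := by
  haveI := isProbabilityMeasure_fwdPathLaw ν₁ h1 κR
  set μ := fwdPathLaw ν₁ κR with hμ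
  set g : E → ℝ := fun ε => Real.exp (ΔF - W ε) / nf + 1 / nr with hgdef
  have hgpos : ∀ ε, 0 < g ε := bennett_g_pos' hnf hnr W ΔF
  have hgm : Measurable g :=
    ((Real.measurable_exp.comp (measurable_const.sub h.measurable_W)).div_const _).add_const _
  have hGi : Integrable (fun ε => (g ε)⁻¹) μ := h.integrable_inv_bennett_g h1 hnf hnr ΔF
  have hG : 0 < ∫ ε, (g ε)⁻¹ ∂μ := h.integral_inv_bennett_g_pos h1 hnf hnr ΔF
  rw [show (∫ ε, (Real.exp (ΔF - W ε) / nf + 1 / nr)⁻¹ ∂μ) = ∫ ε, (g ε)⁻¹ ∂μ from rfl,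
    show (fun ε => (∫ x, α x ∂μ) / (∫ x, (Real.exp (ΔF - W x) / nf + 1 / nr)⁻¹ ∂μ) *
        (Real.exp (ΔF - W ε) / nf + 1 / nr)⁻¹) =
      fun ε => (∫ x, α x ∂μ) / (∫ x, (g x)⁻¹ ∂μ) * (g ε)⁻¹ from rfl,
    h.bennett_substitution h0 h1 hΔF hnf hnr hA hα2 hα2w,
    show (∫ ε, (Real.exp (ΔF - W ε) / nf + 1 / nr) * α ε ^ 2 ∂μ) = ∫ ε, g ε * α ε ^ 2 ∂μ from rfl]
  set A := ∫ ε, α ε ∂μ with hAdef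
  set G := ∫ ε, (g ε)⁻¹ ∂μ with hGdef
  set X := ∫ ε, g ε * α ε ^ 2 ∂μ with hXdef
  -- integrability
  have hαi : Integrable α μ :=
    ((memLp_two_iff_integrable_sq hαm.aestronglyMeasurable).2 hα2).integrable one_le_two
  have hgα2 : Integrable (fun ε => g ε * α ε ^ 2) μ := by
    have hsplit : ∀ ε, g ε * α ε ^ 2 = nf⁻¹ * (Real.exp (ΔF - W ε) * α ε ^ 2) + nr⁻¹ * α ε ^ 2 :=
      fun ε => by simp only [hgdef]; field_simp
    simp_rw [hsplit]
    exact (hα2w.const_mul _).add (hα2.const_mul _)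
  have hsq := integral_mul_sq_mul_integral_inv_sub_sq (μ := μ) hgpos hαi hgα2 hGi hG
  rw [← hAdef, ← hGdef, ← hXdef] at hsq
  have hA2 : 0 < A ^ 2 := by positivity
  -- `V = bound ↔ X·G = A²`
  have step1 : X / A ^ 2 - 1 / nf - 1 / nr = 1 / G - 1 / nf - 1 / nr ↔ X * G - A ^ 2 = 0 := by
    constructor
    · intro heq
      have : X / A ^ 2 = 1 / G := by linarith
      rw [div_eq_div_iff hA2.ne' hG.ne'] at this
      linarith
    · intro hz
      have : X / A ^ 2 = 1 / G := by
        rw [div_eq_div_iff hA2.ne' hG.ne']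
        linarith
      linarith
  rw [step1, hsq, mul_eq_zero, or_iff_right hG.ne']
  -- `∫ g (α − c/g)² = 0 ↔ α = c/g` a.e.
  set c := A / G with hc
  have hnn : 0 ≤ fun ε => g ε * (α ε - c * (g ε)⁻¹) ^ 2 := fun ε => mul_nonneg (hgpos ε).le (sq_nonneg _)
  have hint : Integrable (fun ε => g ε * (α ε - c * (g ε)⁻¹) ^ 2) μ := by
    have hexp : ∀ ε, g ε * (α ε - c * (g ε)⁻¹) ^ 2 =
        g ε * α ε ^ 2 - 2 * c * α ε + c ^ 2 * (g ε)⁻¹ := fun ε => by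
      have hg0 : g ε ≠ 0 := (hgpos ε).ne'
      field_simp
      ring
    simp_rw [hexp]
    exact (hgα2.sub (hαi.const_mul _)).add (hGi.const_mul _)
  rw [integral_eq_zero_iff_of_nonneg hnn hint]
  constructor
  · intro hae
    filter_upwards [hae] with ε hε
    simp only [Pi.zero_apply, mul_eq_zero] at hε
    rcases hε with hg0 | hsq0
    · exact absurd hg0 (hgpos ε).ne'
    · have := pow_eq_zero_iff (two_ne_zero) |>.mp hsq0
      linarith
  · intro hae
    filter_upwards [hae] with ε hε
    simp only [Pi.zero_apply]
    rw [hε, sub_self]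
    ring

end CrooksPair

end Summit.Ventures.LatticeQCDFlow.Exactness.GeneralNCMC
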